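import Mathlib
import Summits.AtomisticToContinuum.Crystallization.Theses.PhononSlackCertificates
import Summits.AtomisticToContinuum.Crystallization.Theorems.PhononSlackCertificatesNearFieldConvexityStubPnfOfLocalCertificate

/-!
# Crux `PhononSlackCertificates.NearFieldConvexity` (stmt-AtomisticToContinuum-13958), line `Sketch`:
piece `stub_roughOfDistortion` of stub `stub_roughSitesPaid` (II_band) — the CHEBYSHEV REDUCTION

The non-perturbative half (II_band) of the split energy stub says: for every tolerance `ε₁ ∈ [1/100, 1/20]` and
every `δ > 0` there are `K ≥ 0`, `C` such that inside a finite set `Ω` of `1/20`-good particles of a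
`δ`-separated configuration (with `2/5`-charts at its radius-3 interior sites) the particles that are not even
`ε₁`-good are paid for linearly: `#{i ∈ Ω : ¬ ε₁-good} ≤ K·[E_self(Ω) − |Ω|·e*] + C·#∂₄Ω`.

This file reduces (II_band) to ONE summed statement about the GOODNESS THRESHOLD
`d(i) := sInf {e : ℝ | 0 ≤ e ∧ IsTwoShellGood e (47/50) 1 x i}` (written inline): if
`Σ_{i∈Ω} d(i)² ≤ K·[E_self(Ω) − |Ω|·e*] + C·#∂₄Ω` then (II_band) holds with `K/ε₁²`, `C/ε₁²`.  Indeed goodness is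
monotone in the tolerance (`IsTwoShellGood.mono`), so for `i ∈ Ω` (the threshold set contains `1/20`) a particle
that is not `ε₁`-good has `ε₁ ≤ d(i)` (`exists_lt_of_csInf_lt`), whence Chebyshev:
`ε₁²·#{i ∈ Ω : ¬ ε₁-good} ≤ Σ_{i∈Ω} d(i)²`.  Toolkit: `goodThreshold_nonneg`, `goodThreshold_le_of_good`,
`good_of_goodThreshold_lt`, `le_goodThreshold_of_not_good`, `sq_mul_natCard_notGood_le`.  All `[folklore]`.
-/

noncomputable section

open scoped BigOperators
open Literature.MathematicalPhysics.StatisticalMechanics Literature.Geometry.DiscreteGeometry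

namespace Summit.AtomisticToContinuum.Crystallization.Theorems.PhononSlackNearFieldConvexity

/-! ### The goodness threshold `d(i) = sInf {e | 0 ≤ e ∧ IsTwoShellGood e (47/50) 1 x i}` -/

/-- **The goodness threshold is nonnegative**: `0 ≤ d(i)` (all members are `≥ 0`; also covers the junk value
`sInf ∅ = 0` at particles that are good for no tolerance). [folklore] -/
theorem goodThreshold_nonneg {N : ℕ} (x : Fin N → EuclideanSpace ℝ (Fin 3)) (i : Fin N) :
    0 ≤ sInf {e : ℝ | 0 ≤ e ∧ IsTwoShellGood e (47 / 50) 1 x i} :=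
  Real.sInf_nonneg fun _ he => he.1

/-- **Good tolerances bound the threshold**: if `0 ≤ ε` and `i` is `ε`-good then `d(i) ≤ ε` (`csInf_le`, the set
being bounded below by `0`).  In particular `d(i) ≤ 1/20` on a set of `1/20`-good particles. [folklore] -/
theorem goodThreshold_le_of_good {N : ℕ} (x : Fin N → EuclideanSpace ℝ (Fin 3)) (i : Fin N) {ε : ℝ}
    (hε : 0 ≤ ε) (h : IsTwoShellGood ε (47 / 50) 1 x i) :
    sInf {e : ℝ | 0 ≤ e ∧ IsTwoShellGood e (47 / 50) 1 x i} ≤ ε :=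
  csInf_le ⟨0, fun _ he => he.1⟩ ⟨hε, h⟩

/-- **Above-threshold tolerances are good**: if `i` is `ε₀`-good for some `ε₀ ≥ 0` (so the threshold set is
nonempty) and `d(i) < ε`, then `i` is `ε`-good (pick a member `e < ε`, `exists_lt_of_csInf_lt`, and use the
monotonicity `IsTwoShellGood.mono` of goodness in the tolerance). [folklore] -/
theorem good_of_goodThreshold_lt {N : ℕ} (x : Fin N → EuclideanSpace ℝ (Fin 3)) (i : Fin N) {ε₀ ε : ℝ}
    (hε₀ : 0 ≤ ε₀) (h₀ : IsTwoShellGood ε₀ (47 / 50) 1 x i)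
    (hlt : sInf {e : ℝ | 0 ≤ e ∧ IsTwoShellGood e (47 / 50) 1 x i} < ε) :
    IsTwoShellGood ε (47 / 50) 1 x i := by
  obtain ⟨e, he, hlt'⟩ := exists_lt_of_csInf_lt (by exact ⟨ε₀, hε₀, h₀⟩) hlt
  exact he.2.mono hlt'.le (by norm_num)

/-- **Bad tolerances are below the threshold**: if `i` is `ε₀`-good for some `ε₀ ≥ 0` but NOT `ε`-good, then
`ε ≤ d(i)` (contrapositive of `good_of_goodThreshold_lt`; no sign hypothesis on `ε`). [folklore] -/
theorem le_goodThreshold_of_not_good {N : ℕ} (x : Fin N → EuclideanSpace ℝ (Fin 3)) (i : Fin N) {ε₀ ε : ℝ}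
    (hε₀ : 0 ≤ ε₀) (h₀ : IsTwoShellGood ε₀ (47 / 50) 1 x i) (hn : ¬ IsTwoShellGood ε (47 / 50) 1 x i) :
    ε ≤ sInf {e : ℝ | 0 ≤ e ∧ IsTwoShellGood e (47 / 50) 1 x i} :=
  not_lt.1 fun hlt => hn (good_of_goodThreshold_lt x i hε₀ h₀ hlt)

/-! ### Chebyshev -/

/-- **Chebyshev for the goodness threshold.**  On a finite set `Ω` of `ε₀`-good particles (`ε₀ ≥ 0`) and for a
tolerance `ε ≥ 0`: `ε²·#{i ∈ Ω : ¬ ε-good} ≤ Σ_{i∈Ω} d(i)²` (each such `i` has `ε ≤ d(i)` by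
`le_goodThreshold_of_not_good`, and the remaining squares are nonnegative). [folklore] -/
theorem sq_mul_natCard_notGood_le {N : ℕ} (x : Fin N → EuclideanSpace ℝ (Fin 3)) (Ω : Finset (Fin N))
    {ε₀ ε : ℝ} (hε₀ : 0 ≤ ε₀) (hε : 0 ≤ ε) (hΩ : ∀ i ∈ Ω, IsTwoShellGood ε₀ (47 / 50) 1 x i) :
    ε ^ 2 * (Nat.card {i : Fin N // i ∈ Ω ∧ ¬ IsTwoShellGood ε (47 / 50) 1 x i} : ℝ) ≤
      ∑ i ∈ Ω, (sInf {e : ℝ | 0 ≤ e ∧ IsTwoShellGood e (47 / 50) 1 x i}) ^ 2 := by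
  classical
  rw [lc_natCard_eq]
  set D : Finset (Fin N) := Ω.filter (fun i => ¬ IsTwoShellGood ε (47 / 50) 1 x i) with hD
  have h1 : ε ^ 2 * (D.card : ℝ) = ∑ _i ∈ D, ε ^ 2 := by
    rw [Finset.sum_const, nsmul_eq_mul, mul_comm]
  have h2 : ∑ _i ∈ D, ε ^ 2 ≤ ∑ i ∈ D, (sInf {e : ℝ | 0 ≤ e ∧ IsTwoShellGood e (47 / 50) 1 x i}) ^ 2 := by
    refine Finset.sum_le_sum fun i hi => ?_
    obtain ⟨hiΩ, hn⟩ := Finset.mem_filter.1 hi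
    exact pow_le_pow_left₀ hε (le_goodThreshold_of_not_good x i hε₀ (hΩ i hiΩ) hn) 2
  have h3 : ∑ i ∈ D, (sInf {e : ℝ | 0 ≤ e ∧ IsTwoShellGood e (47 / 50) 1 x i}) ^ 2 ≤
      ∑ i ∈ Ω, (sInf {e : ℝ | 0 ≤ e ∧ IsTwoShellGood e (47 / 50) 1 x i}) ^ 2 :=
    Finset.sum_le_sum_of_subset_of_nonneg (Finset.filter_subset _ _) fun i _ _ => sq_nonneg _
  rw [h1]
  exact h2.trans h3

/-! ### The registered headline -/

/-- **Registered headline `stub_roughOfDistortion` (piece of `stub_roughSitesPaid`, worker W3): (II_band) from the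
summed squared goodness threshold.**  If `Σ_{i∈Ω} d(i)² ≤ K·[E_self(Ω) − |Ω|·e*] + C·#∂₄Ω` on sets of `1/20`-good
particles of `δ`-separated configurations (with charts at the radius-3 interior sites), then for every
`ε₁ ∈ [1/100, 1/20]`: `#{i ∈ Ω : ¬ ε₁-good} ≤ (K/ε₁²)·[E_self(Ω) − |Ω|·e*] + (C/ε₁²)·#∂₄Ω` (Chebyshev,
`sq_mul_natCard_notGood_le`). [folklore] -/
theorem stub_roughOfDistortion : (∀ δ : ℝ, 0 < δ → ∃ K : ℝ, 0 ≤ K ∧ ∃ C : ℝ, ∀ (N : ℕ) (x : Fin N → EuclideanSpace ℝ (Fin 3)), (∀ i j : Fin N, i ≠ j → δ ≤ dist (x i) (x j)) → ∀ Ω : Finset (Fin N), (∀ i ∈ Ω, IsTwoShellGood (1 / 20) (47 / 50) 1 x i) → (∀ i ∈ Ω, (∀ k : Fin N, dist (x k) (x i) ≤ 3 → k ∈ Ω) → (∃ (A : EuclideanSpace ℝ (Fin 3) →ₗᵢ[ℝ] EuclideanSpace ℝ (Fin 3)) (a h : ℝ) (s : ℤ → ℤ), 47 / 50 ≤ a ∧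 a ≤ 1 ∧ 39 / 50 * a ≤ h ∧ h ≤ 17 / 20 * a ∧ IsHaggSeq s ∧ (fun S : Set (EuclideanSpace ℝ (Fin 3)) => (∀ j : Fin N, dist (x j) (x i) ≤ 2 → ∃ p ∈ S, dist (x j) p ≤ 2 / 5) ∧ (∀ p ∈ S, dist p (x i) ≤ 2 → ∃ j : Fin N, dist (x j) p ≤ 2 / 5)) {p | ∃ m u v : ℤ, p = x i + A (((u : ℝ) • triangularVec₁ a) + ((v : ℝ) • triangularVec₂ a) + ((haggLabel s m : ℝ) • barlowOffset a) + ((m : ℝ) • layerNormal h))})) → (∑ i ∈ Ω, (sInf {e : ℝ | 0 ≤ e ∧ IsTwoShellGood e (47 / 50) 1 x i}) ^ 2) ≤ K * ((∑ i ∈ Ω, (1 / 2 : ℝ) * (∑ j ∈ Ω.erase i, lennardJones (dist (x i) (x j)))) - (Ω.card : ℝ) * (⨅ Q : PeriodicConfiguration 3, Q.energyPerParticle lennardJones)) + C * (Nat.card {i : Fin N // i ∈ Ω ∧ ∃ j : Fin N, j ∉ Ω ∧ dist (x j) (x i) ≤ 4} : ℝ)) → ∀ ε₁ : ℝ, 1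 / 100 ≤ ε₁ → ε₁ ≤ 1 / 20 → ∀ δ : ℝ, 0 < δ → ∃ K : ℝ, 0 ≤ K ∧ ∃ C : ℝ, ∀ (N : ℕ) (x : Fin N → EuclideanSpace ℝ (Fin 3)), (∀ i j : Fin N, i ≠ j → δ ≤ dist (x i) (x j)) → ∀ Ω : Finset (Fin N), (∀ i ∈ Ω, IsTwoShellGood (1 / 20) (47 / 50) 1 x i) → (∀ i ∈ Ω, (∀ k : Fin N, dist (x k) (x i) ≤ 3 → k ∈ Ω) → (∃ (A : EuclideanSpace ℝ (Fin 3) →ₗᵢ[ℝ] EuclideanSpace ℝ (Fin 3)) (a h : ℝ) (s : ℤ → ℤ), 47 / 50 ≤ a ∧ a ≤ 1 ∧ 39 / 50 * a ≤ h ∧ h ≤ 17 / 20 * a ∧ IsHaggSeq s ∧ (fun S : Set (EuclideanSpace ℝ (Fin 3)) => (∀ j : Fin N, dist (x j) (x i) ≤ 2 → ∃ p ∈ S, dist (x j) p ≤ 2 / 5) ∧ (∀ p ∈ S, dist p (x i) ≤ 2 → ∃ j : Fin N, dist (x j) p ≤ 2 / 5)) {p | ∃ m u v : ℤ, p = x i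 + A (((u : ℝ) • triangularVec₁ a) + ((v : ℝ) • triangularVec₂ a) + ((haggLabel s m : ℝ) • barlowOffset a) + ((m : ℝ) • layerNormal h))})) → (Nat.card {i : Fin N // i ∈ Ω ∧ ¬ IsTwoShellGood ε₁ (47 / 50) 1 x i} : ℝ) ≤ K * ((∑ i ∈ Ω, (1 / 2 : ℝ) * (∑ j ∈ Ω.erase i, lennardJones (dist (x i) (x j)))) - (Ω.card : ℝ) * (⨅ Q : PeriodicConfiguration 3, Q.energyPerParticle lennardJones)) + C * (Nat.card {i : Fin N // i ∈ Ω ∧ ∃ j : Fin N, j ∉ Ω ∧ dist (x j) (x i) ≤ 4} : ℝ) := by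
  intro hsq ε₁ hε₁ _hε₁' δ hδ
  obtain ⟨K, hK, C, hKC⟩ := hsq δ hδ
  have hε0 : 0 < ε₁ := by linarith
  have hε2 : 0 < ε₁ ^ 2 := by positivity
  refine ⟨K / ε₁ ^ 2, div_nonneg hK hε2.le, C / ε₁ ^ 2, ?_⟩
  intro N x hsep Ω hΩ hchart
  have h := hKC N x hsep Ω hΩ hchart
  have hch := sq_mul_natCard_notGood_le x Ω (by norm_num : (0 : ℝ) ≤ 1 / 20) hε0.le hΩ
  have hmain := hch.trans h
  rw [div_mul_eq_mul_div, div_mul_eq_mul_div, ← add_div, le_div_iff₀ hε2]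
  linarith
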